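/-
Copyright (c) 2026 the pub-hodgecm-mathlib formalisation cell (harness21).  Prover seat hodgecm-mathlib-A-p19 (g24) — (U) road, U4 modulo the rank-one top-form constant (W2′), 2026-09-01.
-/
import Summits.HodgeConjecture.HodgeConjecture.Theorems.F0P3ArchTopFormWallCompatibleOfRankOneConstant   -- ★ p844932 junction (n5′)
import Literature.NumberTheory.Weil1964.UnitaryArchLocalTopFormHaarWindowAny                              -- ★ p844847 (A-p06 g29): (ii) `archLocalTopFormHaar_diagonal_univ_eq_setLIntegral`
import HarnessLib

/-!
# U4 `ArchTopFormWallCompatible L` (closer ED. 29 row #177 `stub_WallCompat`, in-house) from ONE remaining statement (W2′): the rank-one limit-formula constant of the top-form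
# Haar measure of the indefinite rank-2 block is `−V₂` ((U) road, U4-DISCHARGE; LEAD F0P3a-plan (g10) T9-40; MEMO-U4-NC-v1)

Cell `pub/hodgecm-mathlib`, F0∕P3a, crux H413 (`stmt-HodgeConjecture-24833`, `--supports … --as helper`); namespace
`Summit.HodgeConjecture.HodgeConjecture.Cruxes.H413.F0P3ArchTopFormWallCompatibleModRankOne`.  ONE THEOREM (kernel lane); no def, no `sorry`.  HONEST LABEL: HC_CM is proved only
modulo the 2 remaining named inputs (hLiu418, h413) until rung 0 closes; U4 is NOT proved here.  This is ★ p844932 `archTopFormWallCompatible_of_massEqSource_of_rankOneConstant` with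
its two (ii) inputs DISCHARGED BY NAME by ★ p844847 `archLocalTopFormHaar_diagonal_univ_eq_setLIntegral` (A-p06 (g29): null Cayley-singular locus + exhaustion + local any-window), so
that U4 now reads: `ArchTopFormWallCompatible L ⟸ hR1G`, where `hR1G` = ★ (R1G)'s conclusion body (E = ℂ) for `archLocalTopFormHaar L 2 (diagonal(β₀,β₂)) w` at every complex place and
every real non-degenerate `β` with `re σβ₀ · re σβ₂ < 0`, with the constant `−V₂`, `V₂ := (∫⁻_{source(1_2)} w₀ dλ).toNNReal` (F0P3-p03 (g12) explicit (R1G) transport + A-p06 (g29) disc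
constant, in flight).
* **`archTopFormWallCompatible_of_rankOneConstant (hR1G) : ArchTopFormWallCompatible L`**.
-/

set_option autoImplicit false
set_option linter.dupNamespace false

noncomputable section

open MeasureTheory Measure Set Filter Topology NumberField NumberField.InfinitePlace Matrix
open Literature.MeasureTheory.Group Literature.NumberTheory.Automorphic Literature.NumberTheory.Automorphic.UnitaryGroup
open Literature.NumberTheory.Weil1964 Literature.NumberTheory.Weil1964.UnitaryArchTopForm Literature.NumberTheory.Weil1964.UnitaryArchLocalTopForm
open Literature.NumberTheory.Rogawski1990
open Summit.HodgeConjecture.HodgeConjecture.Cruxes.H413.F0P3ArchTopFormWallCompatible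
open Summit.HodgeConjecture.HodgeConjecture.Cruxes.H413.F0P3ArchTopFormWallCompatibleOfRankOneConstant
open scoped ENNReal NNReal Classical Matrix MatrixGroups Matrix.Norms.Operator ContDiff ComplexConjugate

namespace Summit.HodgeConjecture.HodgeConjecture.Cruxes.H413.F0P3ArchTopFormWallCompatibleModRankOne

/-- **U4 FROM THE RANK-ONE TOP-FORM CONSTANT ALONE** ((ii) discharged by ★ p844847 by name). (in-house plumbing; motivated by Rogawski 1990 §8.2 p. 118, §1.7 p. 6; Varadarajan 1989 §6.4 Thm 22) -/
theorem archTopFormWallCompatible_of_rankOneConstant (L : Type) [Field L] [NumberField L] [IsCMField L]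
    [MeasurableSpace (skewC 2 (Matrix.diagonal fun _ : Fin 2 => ((1 : ℝ) : ℂ)))] [BorelSpace (skewC 2 (Matrix.diagonal fun _ : Fin 2 => ((1 : ℝ) : ℂ)))] [MeasurableSpace (skewC 1 (Matrix.diagonal fun _ : Fin 1 => ((1 : ℝ) : ℂ)))] [BorelSpace (skewC 1 (Matrix.diagonal fun _ : Fin 1 => ((1 : ℝ) : ℂ)))]
    (hR1G : ∀ [MeasurableSpace (GL (Fin 2) ℂ)] [BorelSpace (GL (Fin 2) ℂ)] (w : {w : InfinitePlace L // IsComplex w}) (β : Fin 3 → L) (_hβ : ∀ i, β i ≠ 0)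
      (_hhermβ : ∀ i, (IsCMField.complexConj L (β i) : L) = β i), (w.1.embedding (β 0)).re * (w.1.embedding (β 2)).re < 0 →
      ∀ (f : Matrix (Fin 2) (Fin 2) ℂ → ℂ), ContDiff ℝ 1 f → HasCompactSupport f → ∀ z : Circle,
        Tendsto (fun ψ : ℝ => deriv (fun ψ : ℝ => (2 * Real.sin ψ) •
            ∫ h : ↥(unitaryGroupOfForm (starRingEnd ℂ) ((Matrix.diagonal ![β 0, β 2]).map w.1.embedding)), f (((h * ⟨circleDiagonal 2 ![z * Circle.exp ψ, z * Circle.exp (-ψ)], circleDiagonal_mem_archLocal_diagonal L 2 ![β 0, β 2] w _⟩ * h⁻¹ : ↥(unitaryGroupOfForm (starRingEnd ℂ) ((Matrix.diagonal ![β 0, β 2]).map w.1.embedding))) :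
              GL (Fin 2) ℂ) : Matrix (Fin 2) (Fin 2) ℂ) ∂(archLocalTopFormHaar L 2 (Matrix.diagonal ![β 0, β 2]) w)) ψ)
          (𝓝[≠] 0) (𝓝 ((-(((∫⁻ X in cayleySourceC 2 (Matrix.diagonal fun _ : Fin 2 => ((1 : ℝ) : ℂ)), ENNReal.ofReal (cayleyWeightC 2 (Matrix.diagonal fun _ : Fin 2 => ((1 : ℝ) : ℂ)) X) ∂(lieStdLebesgueC 2 (Matrix.diagonal fun _ : Fin 2 => ((1 : ℝ) : ℂ)))).toNNReal : ℝ≥0) : ℝ)) • f ((z : ℂ) • (1 : Matrix (Fin 2) (Fin 2) ℂ)))) ∧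
        ∀ ψ ∈ Ioo (-1 : ℝ) 1, ψ ≠ 0 → DifferentiableAt ℝ (fun ψ : ℝ => (2 * Real.sin ψ) •
            ∫ h : ↥(unitaryGroupOfForm (starRingEnd ℂ) ((Matrix.diagonal ![β 0, β 2]).map w.1.embedding)), f (((h * ⟨circleDiagonal 2 ![z * Circle.exp ψ, z * Circle.exp (-ψ)], circleDiagonal_mem_archLocal_diagonal L 2 ![β 0, β 2] w _⟩ * h⁻¹ : ↥(unitaryGroupOfForm (starRingEnd ℂ) ((Matrix.diagonal ![β 0, β 2]).map w.1.embedding))) :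
              GL (Fin 2) ℂ) : Matrix (Fin 2) (Fin 2) ℂ) ∂(archLocalTopFormHaar L 2 (Matrix.diagonal ![β 0, β 2]) w)) ψ) :
    ArchTopFormWallCompatible L :=
  archTopFormWallCompatible_of_massEqSource_of_rankOneConstant L
    (fun w b hb hbr _ _ _ _ => archLocalTopFormHaar_diagonal_univ_eq_setLIntegral L 2 w b hb hbr)
    (fun w b hb hbr _ _ _ _ => archLocalTopFormHaar_diagonal_univ_eq_setLIntegral L 1 w b hb hbr)
    hR1G

end Summit.HodgeConjecture.HodgeConjecture.Cruxes.H413.F0P3ArchTopFormWallCompatibleModRankOne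

end
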